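import Mathlib.Combinatorics.SetFamily.FourFunctions
import Mathlib.Data.Fintype.Card
import Mathlib.Algebra.Order.Field.Basic
import Mathlib.Data.Real.Basic
import Mathlib.Tactic
import HarnessLib

/-!
# Monotonicity of a twisted/untwisted ratio along an annealed dilution ray

Solo-blind deliverable D15 (calibration / obstruction infrastructure, not a step on a summit path).

Setting.  `P` is a finite set (plaquettes).  For every subset `S ⊆ P` two numbers are given:
`Z S ≥ 0` (an "untwisted partition function with exactly the plaquettes in `S` active") and
`r S ≥ 0` (the ratio "twisted / untwisted" for the same active set).  For `w ∈ [0,1]` put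
`bernoulliWeight w S = w ^ #S * (1 - w) ^ #Sᶜ` and consider the two mixtures
`Zp w = ∑_S bernoulliWeight w S * Z S` and `Zm w = ∑_S bernoulliWeight w S * Z S * r S`.

Theorem (`dilution_ratio_cross_le`, ratio form `dilution_twistedRatio_antitone`).  If
* `S ↦ Z S` satisfies the FKG lattice condition `Z S * Z T ≤ Z (S ∩ T) * Z (S ∪ T)`, and
* `S ↦ r S` is antitone (`S ⊆ T → r T ≤ r S`),
then `w ↦ Zm w / Zp w` is non-increasing on `(0,1)`:  for `0 ≤ w ≤ w' ≤ 1`,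
`Zm w' * Zp w ≤ Zm w * Zp w'`.

The proof is one application of the Ahlswede–Daykin four functions theorem on the Boolean lattice
`Finset P` (Mathlib `four_functions_theorem_univ`), the pointwise hypothesis factorising into the
odds-ratio inequality for the Bernoulli weights (`bernoulliWeight_cross_le`), the lattice condition
for `Z`, and the antitonicity of `r`.

Use (paper/breaks.md A6(vii), claims c87–c89).  With the lower-bound choice `c^L = 0`, Tomboulis's
interpolation `c̃_j(α) = w(α) c^U_j` (arXiv:0707.2179, (interc1)/(lowerc3)) makes the interpolated
lattice model an annealed plaquette dilution of the upper-bound model, so that his inequality (5.15)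
(`A ≥ A⁻`, i.e. the vortex free energy is non-decreasing in `α`) is exactly the conclusion of this
theorem, with `Z S` the partition function of the upper-bound model restricted to the active set `S`
and `r S` its twisted/untwisted ratio.  For an abelian gauge group and weights in the GKS class the two
hypotheses are Griffiths II (lattice condition) and Ginibre's comparison inequality (antitone ratio);
they are NOT proved here — this file certifies only the combinatorial reduction.
-/

namespace Summit.QuantumFields.YangMills.Theorems.SoloBlind

open Finset

variable {P : Type*} [Fintype P] [DecidableEq P]

/-- Bernoulli product weight of an active set `S`: `w ^ #S * (1 - w) ^ #Sᶜ`. -/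
noncomputable def bernoulliWeight (w : ℝ) (S : Finset P) : ℝ := w ^ #S * (1 - w) ^ #Sᶜ

/-- Bernoulli weights are nonnegative for `w ∈ [0,1]`. -/
lemma bernoulliWeight_nonneg {w : ℝ} (hw0 : 0 ≤ w) (hw1 : w ≤ 1) (S : Finset P) :
    0 ≤ bernoulliWeight w S := by
  unfold bernoulliWeight
  have : 0 ≤ 1 - w := by linarith
  positivity

/-- Bernoulli weights are positive for `w ∈ (0,1)`. -/
lemma bernoulliWeight_pos {w : ℝ} (hw0 : 0 < w) (hw1 : w < 1) (S : Finset P) :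
    0 < bernoulliWeight w S := by
  unfold bernoulliWeight
  have : 0 < 1 - w := by linarith
  positivity

/-- The odds-ratio (log-supermodularity-across-parameters) inequality for Bernoulli weights:
for `w ≤ w'`, `B_{w'}(a) B_w(b) ≤ B_w(a ∩ b) B_{w'}(a ∪ b)`. -/
lemma bernoulliWeight_cross_le {w w' : ℝ} (hw0 : 0 ≤ w) (hww' : w ≤ w') (hw'1 : w' ≤ 1)
    (a b : Finset P) :
    bernoulliWeight w' a * bernoulliWeight w b
      ≤ bernoulliWeight w (a ∩ b) * bernoulliWeight w' (a ∪ b) := by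
  set k := #(b \ a) with hk
  have e1 := card_sdiff_add_card_inter b a
  have e2 := card_union_add_card_inter a b
  have e3 := card_add_card_compl a
  have e4 := card_add_card_compl b
  have e5 := card_add_card_compl (a ∪ b)
  have e6 := card_add_card_compl (a ∩ b)
  rw [Finset.inter_comm b a] at e1
  have h1 : #(a ∪ b) = #a + k := by omega
  have h2 : #b = #(a ∩ b) + k := by omega
  have h3 : #aᶜ = #(a ∪ b)ᶜ + k := by omega
  have h4 : #(a ∩ b)ᶜ = #bᶜ + k := by omega
  unfold bernoulliWeight
  rw [h1, h2, h3, h4]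
  simp only [pow_add]
  have hw'0 : 0 ≤ w' := le_trans hw0 hww'
  have h1w : 0 ≤ 1 - w := by linarith
  have h1w' : 0 ≤ 1 - w' := by linarith
  have hC : 0 ≤ w' ^ #a * (1 - w') ^ #(a ∪ b)ᶜ * w ^ #(a ∩ b) * (1 - w) ^ #bᶜ := by
    positivity
  have hbase : (1 - w') * w ≤ (1 - w) * w' := by nlinarith
  have hk' : ((1 - w') * w) ^ k ≤ ((1 - w) * w') ^ k :=
    pow_le_pow_left₀ (mul_nonneg h1w' hw0) hbase k
  calc w' ^ #a * ((1 - w') ^ #(a ∪ b)ᶜ * (1 - w') ^ k) * (w ^ #(a ∩ b) * w ^ k * (1 - w) ^ #bᶜ)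
        = (w' ^ #a * (1 - w') ^ #(a ∪ b)ᶜ * w ^ #(a ∩ b) * (1 - w) ^ #bᶜ)
            * ((1 - w') * w) ^ k := by rw [mul_pow]; ring
    _ ≤ (w' ^ #a * (1 - w') ^ #(a ∪ b)ᶜ * w ^ #(a ∩ b) * (1 - w) ^ #bᶜ)
            * ((1 - w) * w') ^ k := mul_le_mul_of_nonneg_left hk' hC
    _ = w ^ #(a ∩ b) * ((1 - w) ^ #bᶜ * (1 - w) ^ k)
          * (w' ^ #a * w' ^ k * (1 - w') ^ #(a ∪ b)ᶜ) := by rw [mul_pow]; ring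

/-- **Dilution monotonicity, cross-multiplied form.**  If `Z` satisfies the FKG lattice condition
and `r` is antitone, then for `0 ≤ w ≤ w' ≤ 1`
`(∑ B_{w'} Z r) * (∑ B_w Z) ≤ (∑ B_w Z r) * (∑ B_{w'} Z)`. -/
theorem dilution_ratio_cross_le (Z r : Finset P → ℝ)
    (hZ : ∀ S, 0 ≤ Z S) (hr : ∀ S, 0 ≤ r S)
    (hZlat : ∀ S T, Z S * Z T ≤ Z (S ∩ T) * Z (S ∪ T))
    (hranti : ∀ S T : Finset P, S ⊆ T → r T ≤ r S)
    {w w' : ℝ} (hw0 : 0 ≤ w) (hww' : w ≤ w') (hw'1 : w' ≤ 1) :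
    (∑ S, bernoulliWeight w' S * (Z S * r S)) * (∑ S, bernoulliWeight w S * Z S)
      ≤ (∑ S, bernoulliWeight w S * (Z S * r S)) * (∑ S, bernoulliWeight w' S * Z S) := by
  classical
  have hw'0 : 0 ≤ w' := le_trans hw0 hww'
  have hw1 : w ≤ 1 := le_trans hww' hw'1
  have hB : ∀ S : Finset P, 0 ≤ bernoulliWeight w S := bernoulliWeight_nonneg hw0 hw1
  have hB' : ∀ S : Finset P, 0 ≤ bernoulliWeight w' S := bernoulliWeight_nonneg hw'0 hw'1
  refine four_functions_theorem_univ
    (fun S => bernoulliWeight w' S * (Z S * r S)) (fun S => bernoulliWeight w S * Z S)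
    (fun S => bernoulliWeight w S * (Z S * r S)) (fun S => bernoulliWeight w' S * Z S)
    (fun S => mul_nonneg (hB' S) (mul_nonneg (hZ S) (hr S)))
    (fun S => mul_nonneg (hB S) (hZ S))
    (fun S => mul_nonneg (hB S) (mul_nonneg (hZ S) (hr S)))
    (fun S => mul_nonneg (hB' S) (hZ S)) ?_
  intro a b
  simp only [inf_eq_inter, sup_eq_union]
  have h1 := bernoulliWeight_cross_le hw0 hww' hw'1 a b
  have h2 := hZlat a b
  have h3 : r a ≤ r (a ∩ b) := hranti _ _ inter_subset_left
  have stepA : (bernoulliWeight w' a * bernoulliWeight w b) * (Z a * Z b)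
      ≤ (bernoulliWeight w (a ∩ b) * bernoulliWeight w' (a ∪ b)) * (Z (a ∩ b) * Z (a ∪ b)) :=
    mul_le_mul h1 h2 (mul_nonneg (hZ a) (hZ b)) (mul_nonneg (hB _) (hB' _))
  have stepB : (bernoulliWeight w' a * bernoulliWeight w b) * (Z a * Z b) * r a
      ≤ (bernoulliWeight w (a ∩ b) * bernoulliWeight w' (a ∪ b)) * (Z (a ∩ b) * Z (a ∪ b))
          * r (a ∩ b) :=
    mul_le_mul stepA h3 (hr a)
      (mul_nonneg (mul_nonneg (hB _) (hB' _)) (mul_nonneg (hZ _) (hZ _)))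
  calc bernoulliWeight w' a * (Z a * r a) * (bernoulliWeight w b * Z b)
        = (bernoulliWeight w' a * bernoulliWeight w b) * (Z a * Z b) * r a := by ring
    _ ≤ (bernoulliWeight w (a ∩ b) * bernoulliWeight w' (a ∪ b)) * (Z (a ∩ b) * Z (a ∪ b))
          * r (a ∩ b) := stepB
    _ = bernoulliWeight w (a ∩ b) * (Z (a ∩ b) * r (a ∩ b))
          * (bernoulliWeight w' (a ∪ b) * Z (a ∪ b)) := by ring

/-- **Dilution monotonicity, ratio form.**  Under the FKG lattice condition for `Z` (with `Z > 0`)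
and antitonicity of `r`, the twisted/untwisted ratio of the `w`-mixture,
`(∑ B_w Z r) / (∑ B_w Z)`, is non-increasing in `w ∈ (0,1)`. -/
theorem dilution_twistedRatio_antitone (Z r : Finset P → ℝ)
    (hZ : ∀ S, 0 < Z S) (hr : ∀ S, 0 ≤ r S)
    (hZlat : ∀ S T, Z S * Z T ≤ Z (S ∩ T) * Z (S ∪ T))
    (hranti : ∀ S T : Finset P, S ⊆ T → r T ≤ r S)
    {w w' : ℝ} (hw0 : 0 < w) (hww' : w ≤ w') (hw'1 : w' < 1) :
    (∑ S, bernoulliWeight w' S * (Z S * r S)) / (∑ S, bernoulliWeight w' S * Z S)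
      ≤ (∑ S, bernoulliWeight w S * (Z S * r S)) / (∑ S, bernoulliWeight w S * Z S) := by
  classical
  have hw'0 : 0 < w' := lt_of_lt_of_le hw0 hww'
  have hw1 : w < 1 := lt_of_le_of_lt hww' hw'1
  have pos : ∀ {v : ℝ}, 0 < v → v < 1 → 0 < ∑ S, bernoulliWeight v S * Z S := by
    intro v hv0 hv1
    apply Finset.sum_pos
    · intro S _
      exact mul_pos (bernoulliWeight_pos hv0 hv1 S) (hZ S)
    · exact Finset.univ_nonempty
  rw [div_le_div_iff₀ (pos hw'0 hw'1) (pos hw0 hw1)]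
  exact dilution_ratio_cross_le Z r (fun S => (hZ S).le) hr hZlat hranti hw0.le hww' hw'1.le

end Summit.QuantumFields.YangMills.Theorems.SoloBlind
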